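import Literature.AlgebraicGeometry.Resolution.AlterationsStrictTransformModel
import Literature.AlgebraicGeometry.Resolution.AlterationsStableModelMorphism
import HarnessLib

/-!
# De Jong's alteration theorem: 4.17 reduced to the stable extension over an alteration of the base (2.24)

Topic: `Literature/AlgebraicGeometry/Resolution`. Companion to `AlterationsStableModel.lean`, which
vendors de Jong 1996, 4.17 as ONE named fact `DeJong1996StableModelReduction`: Thm. 4.1 with its
generically-étale clause for a fibred pair `(X, Z)` with (vi) e), f) follows from the same for all
fibred pairs over `k` with (vi) e), f), g) of the same dimension. The printed 4.17 has two
visibly different ingredients: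

> "4.17. Assume (i)–(iv), (vi) a)–f). We define an open subscheme `U ⊂ Y` by the formula
> `U = {y ∈ Y | X_y is smooth over y and σᵢ(y) ≠ σⱼ(y) for i ≠ j}`. By (vi) c) we have `U ≠ ∅`.
> Let `g` denote the genus of `f⁻¹(y)` for `y ∈ U`. In view of (vi) e) we have `n ≥ 3` […],
> hence `(X_U, σ₁|_U, …, σₙ|_U)` is a stable `n`-pointed curve of genus `g` over `U`. This
> defines a 1-morphism `U → M_{g,n}` […] see 2.24 for notation and results. Choose `ℓ ≥ 3` prime
> to the characteristic of `k`. Let `U' ⊂ U ×_{M_{g,n}} ℓM_{g,n}` be an irreducible component; it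
> is finite étale over `U`, nonempty since `ℓ` is prime to the characteristic of `k`. Put `Y'`
> equal to the closure of `Im(U' → Y ×_k ℓM̄_{g,n})`. It is clear that `Y'` is a projective
> variety over `k` and that `ψ : Y' → Y` is an alteration which is generically étale. The smooth
> stable `n`-pointed curve `(X_U, σ₁|_U, …, σₙ|_U) ×_U U'` extends to a stable `n`-pointed curve
> over `Y'`, see 2.24. […]" — the STABLE EXTENSION over a generically étale projective
> alteration of the base, whose input is the theory of 2.24 ("`ℓM_{g,n}` is a scheme […]
> `ℓM̄_{g,n}` is a projective scheme over `Spec ℤ[1/ℓ]`, compare [6]. By pullback from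
> `M̄_{g,n}[1/ℓ]` we get a "universal" stable `n`-pointed curve of genus `g` over `ℓM̄_{g,n}`",
> p. 62);
>
> "Replacing `Y` by `Y'` and `X` by `X'` as in 4.15 we reduce to a case in which (i)–(iv),
> (vi) a)–f) hold and (vi) g) […]. Again we remark that (vi) g) is preserved by operations as in
> 4.15, by putting `𝒞' = 𝒞 ×_Y Y'`, etc." — the STRICT TRANSFORM of 4.15, the named fact
> `DeJong1996StrictTransform` of `AlterationsStrictTransform.lean`, whose consequences for
> (vi) f), g) are PROVED in `AlterationsStrictTransformModel.lean`.

Accordingly this file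

* vendors the NAMED FACT `DeJong1996StableExtension` (**4.17 with 2.24**): for a fibred pair
  `(X, Z)` over `f : X → Y → Spec k`, `k` algebraically closed, with (vi) e) and `Z = ⋃ᵢ σᵢ(Y)`
  for pairwise distinct sections `σᵢ`, there are a projective variety `Y'`, a generically étale
  alteration `ψ : Y' → Y` and a pointed semi-stable model ((vi) g),
  `DeJong1996.HasPointedSemiStableModel`) of the pulled-back family `X ×_Y Y' → Y'` with its
  pulled-back sections `σ'ᵢ = (σᵢ ∘ ψ, 𝟙)` (`DeJong1996.PreSemiStablePair.pullbackSection`) —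
  this is the node that needs the moduli theory of stable pointed curves;
* PROVES **4.17 (`DeJong1996StableModelReduction`) from `DeJong1996StableExtension` and 4.15
  (`DeJong1996StrictTransform`)** (`DeJong1996StableModelReduction.of_stableExtension_of_strictTransform`,
  through `DeJong1996.FibredPair.conclusionGenericallyEtale_of_strictTransform_of_model`), its
  composites down to `DeJong1996StrongAlgClosed` and `DeJong1996Strong` — with 4.15 shared
  between 4.16 (`DeJong1996GaloisNormalization`) and 4.17, and 4.18–4.22a served by
  `DeJong1996StableModelToMorphism` (`AlterationsStableModelMorphism.lean`) — and the elementary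
  API: the pulled-back sections are pairwise distinct sections covering the preimage of `Z`
  (`DeJong1996.IsUnionOfSections.pullback`).

On faithfulness of `DeJong1996StableExtension`. (1) "Stable `n`-pointed" is weakened to "pointed
semi-stable" in (vi) g), as in `AlterationsStableModel.lean` (4.18–4.28 use no more), so the fact
is implied by the printed construction. (2) The isomorphism of (vi) g) is required over SOME
non-empty open of `Y'` only, as printed in (vi) g); the text obtains it over the image of `U'` in
`Y'` (one may take for `Y'` a projective compactification of `U'` over `Y ×_k ℓM̄_{g,n}`, so that
`U' = ψ⁻¹(U)` is open in `Y'` and the universal curve restricts to `(X_U, σ|_U) ×_U U'` there).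
(3) The model `𝒞` is integral and projective over `k`, as `HasPointedSemiStableModel` demands: it
is the pull-back of the universal curve over the projective `ℓM̄_{g,n}`, flat over `Y'` with
reduced fibres and smooth geometrically connected generic fibre (cf. 4.18: "`T` is integral […]
(flat, geometrically reduced and connected fibres over `U` and irreducible generic fibre)").

## Sources

* A. J. de Jong, *Smoothness, semi-stability and alterations*, Publ. Math. IHÉS 83 (1996) 51–93:
  2.18, 2.20 (pp. 60–61), 2.24 (p. 62), Thm. 4.1, 4.4 (p. 66), 4.15–4.17 (pp. 71–72), 4.18 (p. 72),
  5.13 (pp. 80–81, the same construction over a general base).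
-/

noncomputable section

open CategoryTheory CategoryTheory.Limits AlgebraicGeometry TopologicalSpace Topology

namespace Literature.AlgebraicGeometry.Resolution

universe u

namespace DeJong1996

/-! ## Pulled-back sections -/

namespace IsUnionOfSections

variable {X Y Y' : Scheme.{u}} {f : X ⟶ Y} {n : ℕ} {σ : Fin n → (Y ⟶ X)}

/-- The pulled-back sections `σ'ᵢ = (σᵢ ∘ ψ, 𝟙) : Y' → X ×_Y Y'` of pairwise distinct sections
`σᵢ` of a separated `f : X → Y` with `Y` reduced, along a dominant `ψ : Y' → Y` (e.g. an
alteration), are pairwise distinct: `σ'ᵢ = σ'ⱼ` gives `ψ ≫ σᵢ = ψ ≫ σⱼ`, and two sections of the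
separated `f` on the reduced `Y` which agree after the dominant `ψ` agree (their equaliser is a
closed subscheme of `Y` through which `ψ` factors; Mathlib's `ext_of_isDominant_of_isSeparated`).
This is the distinctness part of "(vi) f) is also preserved by alterations as in 4.15" (4.16),
before reduction. [cite: DeJong1996, 4.16, p. 71] -/
theorem injective_pullbackSection [IsReduced Y] [IsSeparated f] (hσ : ∀ i, σ i ≫ f = 𝟙 Y)
    (hinj : Function.Injective σ) (ψ : Y' ⟶ Y) [IsDominant ψ] :
    Function.Injective (PreSemiStablePair.pullbackSection hσ ψ) := by
  intro i j hij
  apply hinj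
  have h := congrArg (fun t => t ≫ pullback.fst f ψ) hij
  simp only [PreSemiStablePair.pullbackSection_fst] at h
  exact ext_of_isDominant_of_isSeparated f (by rw [hσ i, hσ j]) ψ h

/-- The preimage of `Z = ⋃ᵢ σᵢ(Y)` under the projection `X ×_Y Y' → X` is `⋃ᵢ σ'ᵢ(Y')`.
[folklore] -/
theorem preimage_fst_iUnion_range (hσ : ∀ i, σ i ≫ f = 𝟙 Y) (ψ : Y' ⟶ Y) :
    pullback.fst f ψ ⁻¹' (⋃ i, Set.range (σ i)) =
      ⋃ i, Set.range (PreSemiStablePair.pullbackSection hσ ψ i) := by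
  ext x
  simp only [Set.preimage_iUnion, Set.mem_iUnion, PreSemiStablePair.range_pullbackSection,
    Set.mem_preimage]

/-- **"(vi) f) is also preserved by alterations as in 4.15"** (4.16), for the pulled-back family
`X ×_Y Y' → Y'` before reduction: if `Z = ⋃ᵢ σᵢ(Y)` for pairwise distinct sections of the
separated `f` over the reduced `Y`, then `pr⁻¹(Z) = ⋃ᵢ σ'ᵢ(Y')` for the pairwise distinct
pulled-back sections `σ'ᵢ`, `ψ` being dominant. (The same for the strict transform is
`DeJong1996.StrictTransform.isUnionOfSections`.) [cite: DeJong1996, 4.16, p. 71] -/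
theorem pullback [IsReduced Y] [IsSeparated f] {Z : Set X} (h : IsUnionOfSections f Z)
    (ψ : Y' ⟶ Y) [IsDominant ψ] :
    IsUnionOfSections (pullback.snd f ψ) (pullback.fst f ψ ⁻¹' Z) := by
  obtain ⟨n, σ, hinj, hσ, rfl⟩ := h
  exact ⟨n, PreSemiStablePair.pullbackSection hσ ψ, injective_pullbackSection hσ hinj ψ,
    PreSemiStablePair.pullbackSection_snd hσ ψ, preimage_fst_iUnion_range hσ ψ⟩

end IsUnionOfSections

end DeJong1996

/-! ## 4.17 with 2.24 as a named fact -/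

/-- NAMED FACT — **de Jong 1996, 4.17 with 2.24: a pointed stable model over a generically étale
projective alteration of the base.** Over an algebraically closed field `k`, let `(X, Z)` with
`f : X → Y → Spec k` satisfy (i), (iii), (iv), (vi) a)–d) (`DeJong1996.FibredPair f g Z`) and
(vi) e) (`DeJong1996.HasThreeSmoothPoints f Z`), and let `Z = ⋃ᵢ σᵢ(Y)` for pairwise distinct
sections `σ₁, …, σₙ` of `f` ((vi) f)). Then there exist a projective variety `Y'` over `k` (an
integral scheme, projective over `k` via `ψ ≫ g`), a generically étale alteration `ψ : Y' → Y`
(2.20, 2.6), and a pointed semi-stable model of the pulled-back family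
`(X ×_Y Y' → Y', σ'₁, …, σ'ₙ)`, `σ'ᵢ = (σᵢ ∘ ψ, 𝟙)`, over a non-empty open of `Y'` ((vi) g),
`DeJong1996.HasPointedSemiStableModel`): "`U = {y ∈ Y | X_y is smooth over y and σᵢ(y) ≠ σⱼ(y)
for i ≠ j}`. By (vi) c) we have `U ≠ ∅`. Let `g` denote the genus of `f⁻¹(y)` for `y ∈ U`. In
view of (vi) e) we have `n ≥ 3` […], hence `(X_U, σ₁|_U, …, σₙ|_U)` is a stable `n`-pointed
curve of genus `g` over `U`. This defines a 1-morphism `U → M_{g,n}` […]. Choose `ℓ ≥ 3` prime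
to the characteristic of `k`. Let `U' ⊂ U ×_{M_{g,n}} ℓM_{g,n}` be an irreducible component; it
is finite étale over `U`, nonempty since `ℓ` is prime to the characteristic of `k`. Put `Y'`
equal to the closure of `Im(U' → Y ×_k ℓM̄_{g,n})`. It is clear that `Y'` is a projective variety
over `k` and that `ψ : Y' → Y` is an alteration which is generically étale. The smooth stable
`n`-pointed curve `(X_U, σ₁|_U, …, σₙ|_U) ×_U U'` extends to a stable `n`-pointed curve over
`Y'`, see 2.24. (The 1-morphism `U' → U → M_{g,n}` extends to
`Y' → ℓM̄_{g,n} → M̄_{g,n}[1/ℓ] → M̄_{g,n}` by construction.)" Inputs (2.24, after Knudsen [16],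
Deligne [6]): for `g ≥ 0`, `n ≥ 3`, `ℓ ≥ 3` the fine moduli scheme `ℓM_{g,n}` of smooth
`n`-pointed genus-`g` curves with level-`ℓ` structure, finite étale over the stack `M_{g,n}`, and
the projective scheme `ℓM̄_{g,n}` over `ℤ[1/ℓ]` with its "universal" stable `n`-pointed curve.
Rendering: "stable `n`-pointed" is weakened to pointed semi-stable (as everywhere from 4.18 on);
the isomorphism with the pulled-back family is over some non-empty open of `Y'`, as (vi) g)
states it (the text has it over the image of `U'`; compactifying `U'` itself over
`Y ×_k ℓM̄_{g,n}` makes `U' = ψ⁻¹(U)` open in `Y'`); the model is integral and projective over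
`k` (pulled back from the universal curve over the projective `ℓM̄_{g,n}`; flat with reduced
fibres and smooth geometrically connected generic fibre over the integral `Y'`, cf. 4.18). Users
take `(h : DeJong1996StableExtension)`; it is a node to decompose further (the theory of 2.24).
[cite: DeJong1996, 4.17 and 2.24, pp. 62, 71–72] -/
def DeJong1996StableExtension : Prop :=
  ∀ (k : Type u) [Field k] [IsAlgClosed k] (X Y : Scheme.{u}) [IsIntegral Y] (f : X ⟶ Y)
    [LocallyOfFinitePresentation f] (g : Y ⟶ Spec (.of k)) (Z : Set X) (n : ℕ)
    (σ : Fin n → (Y ⟶ X)) (hσ : ∀ i, σ i ≫ f = 𝟙 Y),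
    DeJong1996.FibredPair f g Z → DeJong1996.HasThreeSmoothPoints f Z →
      Function.Injective σ → Z = ⋃ i, Set.range (σ i) →
        ∃ (Y' : Scheme.{u}) (_ : IsIntegral Y') (ψ : Y' ⟶ Y),
          Literature.AlgebraicGeometry.Motives.IsProjectiveOver (Over.mk (ψ ≫ g)) ∧
            IsAlteration ψ ∧ IsGenericallyEtale ψ ∧
              DeJong1996.HasPointedSemiStableModel (pullback.snd f ψ) (ψ ≫ g)
                (DeJong1996.PreSemiStablePair.pullbackSection hσ ψ)

/-! ## The assembly: 4.17 from the stable extension and 4.15 -/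

/-- **de Jong 1996, 4.17 (`DeJong1996StableModelReduction`) from the stable extension over a
generically étale alteration of the base (2.24, `DeJong1996StableExtension`) and the strict
transform 4.15 (`DeJong1996StrictTransform`)**: extend the stable pointed curve over `ψ : Y' → Y`,
then "Replacing `Y` by `Y'` and `X` by `X'` as in 4.15 we reduce to a case in which (i)–(iv),
(vi) a)–f) hold and (vi) g)"
(`DeJong1996.FibredPair.conclusionGenericallyEtale_of_strictTransform_of_model`: the strict
transform is a fibred pair over `Y'` with (vi) e), (vi) f) + g) of dimension `dim X`, one of the
pairs the hypothesis of 4.17 serves, and 4.4 descends along `φ`). [cite: DeJong1996, 4.17, pp. 71–72] -/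
theorem DeJong1996StableModelReduction.of_stableExtension_of_strictTransform
    (h₁ : DeJong1996StableExtension.{u}) (h₂ : DeJong1996StrictTransform.{u}) :
    DeJong1996StableModelReduction.{u} := by
  intro k _ _ X Y _ f _ g Z hP h3 hf hS
  obtain ⟨n, σ, hinj, hσ, hZ⟩ := hf
  obtain ⟨Y', hY', ψ, hproj, hψ, hψe, hmod⟩ := h₁ k X Y f g Z n σ hσ hP h3 hinj hZ
  haveI := hY'
  exact hP.conclusionGenericallyEtale_of_strictTransform_of_model h₂ hσ h3 hinj hZ ψ hproj hψ hψe
    hmod fun X' f' _ Z' hP' h3' hfg' hdim' => hS X' Y' f' (ψ ≫ g) Z' hP' h3' hfg' hdim'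

/-- **4.17–4.22a (`DeJong1996SectionsToPreSemiStablePair`) from 2.24 (`DeJong1996StableExtension`),
4.15 (`DeJong1996StrictTransform`) and 4.18–4.22a (`DeJong1996StableModelToPreSemiStablePair`).**
[cite: DeJong1996, 4.15–4.22, pp. 71–74] -/
theorem DeJong1996SectionsToPreSemiStablePair.of_stableExtension_of_strictTransform_of_toPre
    (h₁ : DeJong1996StableExtension.{u}) (h₂ : DeJong1996StrictTransform.{u})
    (h₃ : DeJong1996StableModelToPreSemiStablePair.{u}) :
    DeJong1996SectionsToPreSemiStablePair.{u} :=
  DeJong1996SectionsToPreSemiStablePair.of_stableModel_of_toPre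
    (DeJong1996StableModelReduction.of_stableExtension_of_strictTransform h₁ h₂) h₃

/-- **4.17–4.22a from 2.24, 4.15 and the three-point lemma node `DeJong1996StableModelToMorphism`**
(4.18–4.21 with 4.22 up to "`β` extends", `AlterationsStableModelMorphism.lean`).
[cite: DeJong1996, 4.15–4.22, pp. 71–74] -/
theorem DeJong1996SectionsToPreSemiStablePair.of_stableExtension_of_strictTransform_of_toMorphism
    (h₁ : DeJong1996StableExtension.{u}) (h₂ : DeJong1996StrictTransform.{u})
    (h₃ : DeJong1996StableModelToMorphism.{u}) : DeJong1996SectionsToPreSemiStablePair.{u} :=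
  DeJong1996SectionsToPreSemiStablePair.of_stableModel_of_toMorphism
    (DeJong1996StableModelReduction.of_stableExtension_of_strictTransform h₁ h₂) h₃

/-- **`DeJong1996StrongAlgClosed` (Thm. 4.1 with its generically-étale clause over algebraically
closed fields) with 4.15 (`DeJong1996StrictTransform`) shared by 4.16 and 4.17**: the nodes of
4.15–4.22a are then 4.15, the Galois normalisation of 4.16 (`DeJong1996GaloisNormalization`), the
stable extension 2.24/4.17 (`DeJong1996StableExtension`) and the three-point lemma node
(`DeJong1996StableModelToMorphism`); the other blocks are 4.11–4.12, 4.14, 4.22b, 4.23–4.28.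
[cite: DeJong1996, 4.3–4.28, pp. 66–76] -/
theorem DeJong1996StrongAlgClosed.of_blocks_strictTransform
    (h₀ : DeJong1996FibrationReduction.{u}) (h14 : DeJong1996MultisectionReduction.{u})
    (h415 : DeJong1996StrictTransform.{u}) (h416 : DeJong1996GaloisNormalization.{u})
    (h417 : DeJong1996StableExtension.{u}) (h418 : DeJong1996StableModelToMorphism.{u})
    (h422 : DeJong1996PreSemiStablePairToSemiStablePair.{u})
    (hres : DeJong1996SemiStablePairResolution.{u}) : DeJong1996StrongAlgClosed.{u} :=
  DeJong1996StrongAlgClosed.of_sixBlocks h₀ h14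
    (DeJong1996SectionsReduction.of_strictTransform_of_galoisNormalization h415 h416)
    (DeJong1996SectionsToPreSemiStablePair.of_stableExtension_of_strictTransform_of_toMorphism
      h417 h415 h418) h422 hres

/-- Thm. 4.1 (i)+(ii) over every field from 4.5 (`DeJong1996Descent`) and the same blocks, 4.15
shared. [cite: DeJong1996, 4.3–4.28, pp. 66–76] -/
theorem DeJong1996Strong.of_descent_of_blocks_strictTransform (h45 : DeJong1996Descent.{u})
    (h₀ : DeJong1996FibrationReduction.{u}) (h14 : DeJong1996MultisectionReduction.{u})
    (h415 : DeJong1996StrictTransform.{u}) (h416 : DeJong1996GaloisNormalization.{u})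
    (h417 : DeJong1996StableExtension.{u}) (h418 : DeJong1996StableModelToMorphism.{u})
    (h422 : DeJong1996PreSemiStablePairToSemiStablePair.{u})
    (hres : DeJong1996SemiStablePairResolution.{u}) : DeJong1996Strong.{u} :=
  DeJong1996Strong.of_descent_of_sixBlocks h45 h₀ h14
    (DeJong1996SectionsReduction.of_strictTransform_of_galoisNormalization h415 h416)
    (DeJong1996SectionsToPreSemiStablePair.of_stableExtension_of_strictTransform_of_toMorphism
      h417 h415 h418) h422 hres

/-- Thm. 4.1 (i)+(ii) and its last sentence from the limit argument of 4.5
(`DeJong1996.FiniteSubextension45`) and the same blocks. [cite: DeJong1996, Thm. 4.1, p. 66] -/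
theorem DeJong1996Strong.of_finiteSubextension45_of_blocks_strictTransform
    (H : DeJong1996.FiniteSubextension45.{u}) (h₀ : DeJong1996FibrationReduction.{u})
    (h14 : DeJong1996MultisectionReduction.{u}) (h415 : DeJong1996StrictTransform.{u})
    (h416 : DeJong1996GaloisNormalization.{u}) (h417 : DeJong1996StableExtension.{u})
    (h418 : DeJong1996StableModelToMorphism.{u})
    (h422 : DeJong1996PreSemiStablePairToSemiStablePair.{u})
    (hres : DeJong1996SemiStablePairResolution.{u}) :
    DeJong1996Strong.{u} ∧ DeJong1996StrongPerfect.{u} :=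
  DeJong1996Strong.of_finiteSubextension45_of_sixBlocks H h₀ h14
    (DeJong1996SectionsReduction.of_strictTransform_of_galoisNormalization h415 h416)
    (DeJong1996SectionsToPreSemiStablePair.of_stableExtension_of_strictTransform_of_toMorphism
      h417 h415 h418) h422 hres

end Literature.AlgebraicGeometry.Resolution

end
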